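import Summits.HodgeConjecture.CorCM.GaloisOddMetacyclicCertificates
import HarnessLib

/-!
# Balanced-set certificates for BICYCLIC Galois groups `ℤ/n ⋊_r ℤ/2^{k+1}` with a prescribed complex conjugation

COR-CM (cell `pub-hodgecm2`), binder seat b04 (gen 27), count-neutral — the certificate FORMAT for the order-32 census rows of
gen 23 that were «computed only» (A7-JUNCTION gen-23 table: #35 `C₄ ⋊ C₈`, #43 `C₈ ⋊₅ C₄`, #44 `C₈ ⋊₃ C₄`, #45 `C₈ ⋊₋₁ C₄`, BAD for
every central involution): gen 26's `GaloisOddMetacyclic.exists_simple_degenerate_of_metacyclic_balanced` with the odd prime `p`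
replaced by ANY modulus `n` and the complex conjugation no longer forced (a `2`-group has several central involutions) but
PRESCRIBED by a hypothesis `hc`.  Pure transport of gen 20's `GaloisModels.exists_simple_degenerate_of_table_balanced` along
`Gal(K/ℚ) ≃* Multiplicative (ZMod n) ⋊[φ] Multiplicative (ZMod 2^{k+1}) ≃ ℤ/n × ℤ/2^{k+1}`, `u^v y^s ↦ (v, s)`, law
`(v₁,s₁)(v₂,s₂) = (v₁ + r^{s₁}v₂, s₁+s₂)` (`φ(1) = (·)^r`).  KERNEL ONLY: theorems; no definition, no named fact, no `sorry`.
`HC_CM` is neither used nor claimed.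

* **`exists_simple_degenerate_of_bicyclic_balanced`** — CM set `T₀` for `c₀ = (c₁, c₂)`, trivial left stabiliser, balanced `D`,
  `c₀ D ≠ D` ⟹ a simple DEGENERATE CM abelian variety of dimension `2^k n` with a `(q,q)` class outside the divisor ring on a power.

## References

* [Shimura1998] G. Shimura, *Abelian Varieties with Complex Multiplication and Modular Functions*, §6.2 Thm. 3, §8.2 Prop. 26.
* [Gordon1999HodgeAVSurvey] B. B. Gordon, *A survey of the Hodge conjecture for abelian varieties*, Thm. 6.4, §9.3.
-/

noncomputable section

open CategoryTheory CategoryTheory.Limits NumberField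
open scoped BigOperators

namespace Summit.HodgeConjecture.CorCM.GaloisBicyclic

open Literature.NumberTheory.ComplexMultiplication
open Literature.AlgebraicGeometry.Motives (AbelianVariety CMType)
open Literature.AlgebraicGeometry.HodgeTheory
open Literature.AlgebraicGeometry.ComplexMultiplication (IsCMTypeRealisation)
open Literature.AlgebraicGeometry.Pohlmann1968
open Literature.Barriers.HodgeConjecture (divisorClassesSpan)
open Summit.HodgeConjecture.CorCM.GaloisModels (exists_simple_degenerate_of_table_balanced)
open Summit.HodgeConjecture.CorCM.GaloisOddMetacyclic (toAdd_mul_left)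

variable {n k : ℕ}
variable {K : Type} [Field K] [NumberField K] [IsCMField K] [IsGalois ℚ K]

/-- **BALANCED-SET CERTIFICATE ⟹ a simple DEGENERATE CM abelian variety, for `Gal(K/ℚ) ≅ ℤ/n ⋊_r ℤ/2^{k+1}` with complex
conjugation `u^{c₁} y^{c₂}`.**  `e : Gal(K/ℚ) ≃* Multiplicative (ZMod n) ⋊[φ] Multiplicative (ZMod (2^(k+1)))`, `φ(1) = (·)^r`; in the
coordinates `(v, s) ↔ u^v y^s` with the law `(v₁,s₁)(v₂,s₂) = (v₁ + r^{s₁} v₂, s₁ + s₂)`: a CM set `T₀` (`x ∈ T₀ ↔ c₀ x ∉ T₀`,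
`c₀ = (c₁, c₂)` the image of complex conjugation) with trivial left stabiliser and a finite `D` with `2·#{x ∈ D : x g ∈ T₀} = #D`
for all `g` and `c₀ D ≠ D` give a simple degenerate abelian variety of dimension `2^k n` with CM by `K` and a rational `(q,q)` class
outside the divisor ring on some power. [cite: Shimura1998, §6.2 Thm. 3 and §8.2 Prop. 26] [cite: Gordon1999HodgeAVSurvey, Thm. 6.4 and §9.3] -/
theorem exists_simple_degenerate_of_bicyclic_balanced [NeZero n] (r : ℕ)
    (φ : Multiplicative (ZMod (2 ^ (k + 1))) →* MulAut (Multiplicative (ZMod n)))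
    (hφ : ∀ v : Multiplicative (ZMod n), φ (Multiplicative.ofAdd 1) v = v ^ r)
    (e : (K ≃ₐ[ℚ] K) ≃* Multiplicative (ZMod n) ⋊[φ] Multiplicative (ZMod (2 ^ (k + 1))))
    (c₀ : ZMod n × ZMod (2 ^ (k + 1)))
    (hc : e ((IsCMField.complexConj K).restrictScalars ℚ) =
      SemidirectProduct.inl (Multiplicative.ofAdd c₀.1) * SemidirectProduct.inr (Multiplicative.ofAdd c₀.2))
    (T₀ : Finset (ZMod n × ZMod (2 ^ (k + 1))))
    (hcm : ∀ x : ZMod n × ZMod (2 ^ (k + 1)), x ∈ T₀ ↔ (c₀.1 + (r : ZMod n) ^ c₀.2.val * x.1, c₀.2 + x.2) ∉ T₀)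
    (hprim : ∀ v : ZMod n × ZMod (2 ^ (k + 1)), v ≠ ((0 : ZMod n), (0 : ZMod (2 ^ (k + 1)))) →
      ∃ w : ZMod n × ZMod (2 ^ (k + 1)), ¬ (w ∈ T₀ ↔ (v.1 + (r : ZMod n) ^ v.2.val * w.1, v.2 + w.2) ∈ T₀))
    (D : Finset (ZMod n × ZMod (2 ^ (k + 1))))
    (hbal : ∀ g : ZMod n × ZMod (2 ^ (k + 1)),
      2 * (D.filter fun x => (x.1 + (r : ZMod n) ^ x.2.val * g.1, x.2 + g.2) ∈ T₀).card = D.card)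
    (hmov : ∃ x ∈ D, (c₀.1 + (r : ZMod n) ^ c₀.2.val * x.1, c₀.2 + x.2) ∉ D) :
    ∃ (Φ : CMType K) (φ₀ : K →+* ℂ) (A : AbelianVariety ℂ) (ι : 𝓞 K →+* End A)
      (θ : K →+* Module.End ℂ (complexBetti A.X 1)),
      IsPrimitive (ℂ ≃+* ℂ) Φ.1 φ₀ ∧ ¬ IsNondegenerate Φ ∧ IsCMTypeRealisation Φ A ι θ ∧ A.IsSimple ∧
      A.dim = 2 ^ k * n ∧
      ∃ m q : ℕ, ∃ x : complexBetti (⨁ fun _ : Fin m => A).X (2 * q), IsRationalClass x ∧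
        IsOfHodgeType (⨁ fun _ : Fin m => A).dim (⨁ fun _ : Fin m => A).X (2 * q) q q x ∧
        x ∉ divisorClassesSpan (⨁ fun _ : Fin m => A).X (⨁ fun _ : Fin m => A).dim q := by
  classical
  haveI : NeZero (2 ^ (k + 1)) := ⟨by positivity⟩
  -- the coordinates `u^v y^s ↦ (v, s)`
  set e' : (K ≃ₐ[ℚ] K) ≃ ZMod n × ZMod (2 ^ (k + 1)) :=
    e.toEquiv.trans (SemidirectProduct.equivProd.trans (Equiv.prodCongr Multiplicative.toAdd Multiplicative.toAdd))
    with he'_def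
  have he' : ∀ σ : K ≃ₐ[ℚ] K, e' σ = (Multiplicative.toAdd (e σ).left, Multiplicative.toAdd (e σ).right) := fun σ => rfl
  have hmul : ∀ σ τ : K ≃ₐ[ℚ] K, e' (σ * τ) =
      (fun x y : ZMod n × ZMod (2 ^ (k + 1)) => (x.1 + (r : ZMod n) ^ x.2.val * y.1, x.2 + y.2)) (e' σ) (e' τ) :=
    fun σ τ => by
    simp only [he', map_mul]
    rw [toAdd_mul_left r φ hφ, SemidirectProduct.mul_right, toAdd_mul, Nat.cast_pow]
  have hc' : e' ((IsCMField.complexConj K).restrictScalars ℚ) = c₀ := by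
    rw [he', hc]
    simp [SemidirectProduct.mul_left, SemidirectProduct.mul_right]
  have ho : e' 1 = ((0 : ZMod n), (0 : ZMod (2 ^ (k + 1)))) := by
    rw [he', map_one, SemidirectProduct.one_left, SemidirectProduct.one_right, toAdd_one, toAdd_one]
  have hcm' : ∀ x : ZMod n × ZMod (2 ^ (k + 1)), x ∈ T₀ ↔
      (fun x y : ZMod n × ZMod (2 ^ (k + 1)) => (x.1 + (r : ZMod n) ^ x.2.val * y.1, x.2 + y.2)) c₀ x ∉ T₀ := hcm
  have hmov' : ∃ x ∈ D,
      (fun x y : ZMod n × ZMod (2 ^ (k + 1)) => (x.1 + (r : ZMod n) ^ x.2.val * y.1, x.2 + y.2)) c₀ x ∉ D := hmov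
  have h := exists_simple_degenerate_of_table_balanced
    (fun x y : ZMod n × ZMod (2 ^ (k + 1)) => (x.1 + (r : ZMod n) ^ x.2.val * y.1, x.2 + y.2))
    e' hmul _ hc' _ ho T₀ hcm' hprim D hbal hmov'
  have hcard : Fintype.card (ZMod n × ZMod (2 ^ (k + 1))) / 2 = 2 ^ k * n := by
    rw [Fintype.card_prod, ZMod.card, ZMod.card, pow_succ, show n * (2 ^ k * 2) = 2 ^ k * n * 2 by ring,
      Nat.mul_div_cancel _ (by norm_num)]
  rwa [hcard] at h

end Summit.HodgeConjecture.CorCM.GaloisBicyclic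

end
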